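import Literature.IUT.HodgeArakelov.EtaleThetaDataOfSettingInversionSq

/-!
# [IUTchII] Rmk 1.4.1 (ii) at the MODEL: the RELATIVE inhabitant of `PointedInversion E D` at `D := etaleThetaDataOfSetting'`
# (the pointed inversion `(ι_Ÿ, D_{μ_-})` of `Π := Π^tp_X̲̲`; GAP row G-w4d010-2 (R1) custody)

abc-iut cell (WAVE-5 seat abc-iut-w5-d072; cone of [IUTchIII] Cor. 3.12; DAG nodes **IUTchII:Rmk1.4.1(ii)** / **IUTchII:Prop2.2(i)(ii)** /
**IUTchII:Cor1.12**; plan/GAP-LEDGER.md D-G-w4d010-2f and -2g; INHABITANT CENSUS of abc-iut-w5-d109 2026-08-26T02:25Z: «`PointedInversion`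
(v2 of record) — no inhabitant of any kind; the (α, β) pair GO'd to w5-d072 is exactly the owed inhabitant»). S. Mochizuki,
*Inter-universal Teichmüller theory II*, kurims manuscript (Dec. 2020), Rmk. 1.4.1 (ii) pp. 28–29 («the unique order two
`Δ^tp_{X̲̲_k}`-outer automorphism of `Π^tp_{X̲̲_k}` over `G_k`», «`D_{μ_-} ⊆ Π_{Ÿ̲_k}` for the decomposition group of `(μ_-)_Ÿ`», «an
étale theta function of standard type is defined precisely by the condition that its restriction to `D_{μ_-}` be a `2l`-th root of
unity»), Rmk. 2.1.1 (i) p. 65, Prop. 2.2 p. 66 (claim key `Mochizuki2012`, DISPUTED, D-0012); [EtTh] Def. 2.7 p. 41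
[cite: MochizukiEtTh2009, Def 2.7 p.41].

abc-iut-L6-t1's `PointedInversion E D` (`MonoThetaProjective.lean` v2, FROZEN) is the OUTPUT type of Rmk. 1.4.1 (ii) and the BINDER
of `ThetaEvaluation T E I` (Cor. 1.12, `ConstantMultipleRigidity.lean`), of `Prop22_i' R T D ι₀` (`ThetaEvaluationSettingR.lean`) and
of the Cor. 2.4 (ii) torsion lemmas. THIS FILE constructs its inhabitant at the MODEL `D := etaleThetaDataOfSetting'` (abc-iut-L6-t1,
over abc-iut-L2-t8's `C : E.DoubleUnderline l`) RELATIVE TO NAMED PRINT INPUTS, for any `Env : EnvOfGroup S Π` and any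
automorphism pair datum `α` as in (R1) (in particular `α := inversionAlpha C ι hι` of `EtaleThetaDataOfSettingInversion.lean`):
* CONSTRUCTED: `iota := α`; `iotaYdd := α|Π_Ÿ(Π)` (`iotaYddOfAut`, from (H1) `PiYddCharacteristic C`) with `iotaYdd_lifts` PROVED
  (`δ := 1`); `HDmu := H¹(D_{μ_-}, l·Δ_Θ)` (REAL continuous cohomology, L2's `ContH1`) with `resDmu :=` restriction `∘ h1Top`
  (`resDmuOf`); **`iota_not_inner` PROVED** from `toLZ (α γ) = −1` (`not_inner_of_toLZ`: an inner automorphism preserves the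
  abelian quotient `toLZ : Π^tp_X̲̲ ↠ ℤ`, but `α` sends a generator to its inverse — [IUTchII] Rmk. 2.1.1 (i));
* NAMED INPUTS (binders, print-shaped; nothing smuggled as a `Prop` definition): `hover` («over `G_k`»), `δ`/`hδ`/`hαα` («order two»
  as an OUTER automorphism: `α² = conj δ`, `δ ∈ Δ`), `huniq` («the UNIQUE order two `Δ`-outer automorphism over `G_k`» — tempered
  anabelian content), `Dmu ≤ Π_Ÿ(Π)` with `hfix` («`ι_Ÿ` … fix[es] the … orbit of `(μ_-)_Ÿ`»), `etaStd ∈ orbitOne` with `hstd`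
  (standard type: `(2·l) • resDmu etaStd = 0`).
Hence `pointedInversionOfPair` and, at the (R1) inversion, `pointedInversionOfInversion` (with `iota_sq_inner` from abc-iut-w5-d072's
`inversionAlpha_inversionAlpha_of_sq`, `iota_not_inner` from `toLZ_inversionAlpha_generator`). [claim: Mochizuki2012, status: disputed]
Nothing here takes a side on [IUTchIII] Cor. 3.12; instantiated ≠ endorsed; typed ≠ proved for the named inputs.
-/

namespace Literature.IUT.HodgeArakelov

open Literature.AnabelianGeometry.EtaleTheta (ContH1 ThetaSetting)
open EtaleThetaDataOfSetting CohomologySystemOfContH1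

noncomputable section

namespace EtaleThetaDataOfSetting

variable {p : ℕ} [Fact p.Prime] {D : Literature.AnabelianGeometry.EtaleTheta.ThetaSetting p}
  {E : D.EtaleThetaData} {l : ℕ} (C : E.DoubleUnderline l)

/-! ## §1. The pieces constructed at the model -/

/-- **`ι_Ÿ := α|Π_Ÿ(Π)`**: the restriction of a topological automorphism `α` of `Π := Π^tp_X̲̲` to `Π_Ÿ(Π) = Π^tp_Ÿ̲̲`, which `α`
maps onto itself by (H1) `PiYddCharacteristic C` ([IUTchII] Rmk. 1.4.1 (ii): «an order two automorphism `ι_Ÿ` of `Ÿ̲_k` lifting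
`ι_X̲̲`»). DEFINED. [claim: Mochizuki2012, status: disputed] (IUTchII §1 Rmk 1.4.1 (ii), kurims p.28) -/
def iotaYddOfAut (hchar : PiYddCharacteristic C) (α : (Pi C) ≃ₜ* (Pi C)) : ↥(PiYdd C) ≃* ↥(PiYdd C) :=
  (α.toMulEquiv.subgroupMap (PiYdd C)).trans (MulEquiv.subgroupCongr (hchar α))

/-- `ι_Ÿ` is `α` on underlying elements. [claim: Mochizuki2012, status: disputed] (IUTchII §1 Rmk 1.4.1 (ii), kurims p.28) -/
@[simp] theorem coe_iotaYddOfAut (hchar : PiYddCharacteristic C) (α : (Pi C) ≃ₜ* (Pi C)) (y : PiYdd C) :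
    ((iotaYddOfAut C hchar α y : PiYdd C) : Pi C) = α (y : Pi C) :=
  rfl

/-- **`H¹(D_{μ_-}, (l·Δ_Θ)(Π))` with its restriction map from `H¹(Π_Ÿ(Π), (l·Δ_Θ)(Π))`** ([IUTchII] Rmk. 1.4.1 (ii): «its restriction
to `D_{μ_-}`»), for a subgroup `Dmu ≤ Π_Ÿ(Π)`: REAL continuous cohomology (L2 `ContH1`) and `ContH1.res ∘ h1Top`. DEFINED.
[claim: Mochizuki2012, status: disputed] (IUTchII §1 Rmk 1.4.1 (ii), kurims p.29) -/
def resDmuOf (Dmu : Subgroup (Pi C)) (hDmu : Dmu ≤ PiYdd C) :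
    (coh C).H1 ⊤ →+ Additive (ContH1 (phi C) (D.lDeltaTheta l) Dmu) :=
  (MonoidHom.toAdditive (ContH1.res (phi C) (D.lDeltaTheta l)
      (show Dmu ≤ PiYdd C ⊓ ⊤ from fun x hx => Subgroup.mem_inf.mpr ⟨hDmu hx, Subgroup.mem_top x⟩))).comp
    (h1Top C).toAddMonoidHom

/-- **An automorphism reversing the `ℤ`-torsor is NOT inner** ([IUTchII] Rmk. 2.1.1 (i) / Rmk. 1.4.1 (ii) «outer»): if
`toLZ (α γ) = −1` for a `toLZ`-generator `γ` (`toLZ γ = 1`), then `α` is conjugation by NO element of `Π^tp_X̲̲` — conjugation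
preserves the abelian quotient `toLZ : Π^tp_X̲̲ ↠ ℤ` (abc-iut-L2-t8), and `1 ≠ −1` in `ℤ`. PROVED.
[claim: Mochizuki2012, status: disputed] (IUTchII §2 Rmk 2.1.1 (i), kurims p.65) -/
theorem not_inner_of_toLZ (α : (Pi C) ≃ₜ* (Pi C)) (γ : Pi C) (hγ : C.toLZ γ = Multiplicative.ofAdd 1)
    (hαγ : C.toLZ (α γ) = Multiplicative.ofAdd (-1)) (Q : Pi C → Prop) :
    ¬ ∃ δ : Pi C, Q δ ∧ ∀ x : Pi C, α x = δ * x * δ⁻¹ := by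
  rintro ⟨δ, -, hδ⟩
  have h : C.toLZ (α γ) = C.toLZ γ := by
    rw [hδ γ, map_mul, map_mul, map_inv, mul_inv_cancel_comm]
  rw [hγ, hαγ] at h
  have h' := Multiplicative.ofAdd.injective h
  omega

/-! ## §2. `PointedInversion E D` at the model, relative to the named print inputs -/

section Pair

/-- **The pointed inversion `(ι_Ÿ, D_{μ_-})` of [IUTchII] Rmk. 1.4.1 (ii) AT THE MODEL** — an inhabitant of abc-iut-L6-t1's
`PointedInversion Env (etaleThetaDataOfSetting' …)` built from: an automorphism `α` of `Π := Π^tp_X̲̲` (the pointed inversion; e.g.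
`inversionAlpha C ι hι`) over `G_k` (`hover`), of order two as an outer automorphism (`α² = conj δ`, `δ ∈ Δ`: `δ`, `hδ`, `hαα`),
REVERSING the `ℤ`-torsor at a generator `γ` (`hγ`, `hαγ` — whence `iota_not_inner`, PROVED), unique as such (`huniq` — «the unique
order two `Δ`-outer automorphism», tempered anabelian input BY NAME); the decomposition group `D_{μ_-} ≤ Π_Ÿ(Π)` fixed by `ι_Ÿ` up to
`Δ_Ÿ`-conjugacy (`Dmu`, `hDmu`, `hfix`); and the distinguished STANDARD member `etaStd` of the orbit `η̈^{Θ,l·ℤ×μ₂}` («its restriction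
to `D_{μ_-}` [is] a `2l`-th root of unity»: `hmem`, `hstd`). `iotaYdd`, `HDmu`, `resDmu`, `iotaYdd_lifts`, `iota_not_inner` are
CONSTRUCTED/PROVED here. [claim: Mochizuki2012, status: disputed] (IUTchII §1 Rmk 1.4.1 (ii), kurims pp.28-29) -/
def pointedInversionOfPair (hC : D.Compat) (hS : D.Sec2Hyps) (hchar : PiYddCharacteristic C)
    (S : ThetaSetting.{0}) (eS : (Pi C) ≃ₜ* S.PiX) (hl : S.l = l) (Env : EnvOfGroup S (Pi C)) (α : (Pi C) ≃ₜ* (Pi C))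
    (hover : ∀ x : Pi C, Env.recon.projG (Env.isoX (α x)) = Env.recon.projG (Env.isoX x))
    (δ : Pi C) (hδ : Env.recon.projG (Env.isoX δ) = 1) (hαα : ∀ x : Pi C, α (α x) = δ * x * δ⁻¹)
    (γ : Pi C) (hγ : C.toLZ γ = Multiplicative.ofAdd 1) (hαγ : C.toLZ (α γ) = Multiplicative.ofAdd (-1))
    (huniq : ∀ κ : (Pi C) ≃ₜ* (Pi C),
      (∀ x : Pi C, Env.recon.projG (Env.isoX (κ x)) = Env.recon.projG (Env.isoX x)) →
      (∃ δ' : Pi C, Env.recon.projG (Env.isoX δ') = 1 ∧ ∀ x : Pi C, κ (κ x) = δ' * x * δ'⁻¹) →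
      (¬ ∃ δ' : Pi C, Env.recon.projG (Env.isoX δ') = 1 ∧ ∀ x : Pi C, κ x = δ' * x * δ'⁻¹) →
        ∃ δ' : Pi C, Env.recon.projG (Env.isoX δ') = 1 ∧ ∀ x : Pi C, κ x = δ' * α x * δ'⁻¹)
    (Dmu : Subgroup (Pi C)) (hDmu : Dmu ≤ PiYdd C)
    (hfix : ∃ δ' : ↥(PiYdd C), Env.recon.projG (Env.isoX (δ' : Pi C)) = 1 ∧
      ∀ d : Pi C, ∀ hd : d ∈ Dmu, ((iotaYddOfAut C hchar α ⟨d, hDmu hd⟩ : PiYdd C) : Pi C) ∈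
        Dmu.map (MulAut.conj (δ' : Pi C)).toMonoidHom)
    (etaStd : (coh C).H1 ⊤) (hmem : etaStd ∈ orbitOne C hC) (hstd : (2 * S.l) • resDmuOf C Dmu hDmu etaStd = 0) :
    PointedInversion Env (etaleThetaDataOfSetting' C hC hS hchar S eS hl) where
  iota := α
  iota_over_G := hover
  iota_sq_inner := ⟨δ, hδ, hαα⟩
  iota_not_inner := not_inner_of_toLZ C α γ hγ hαγ _
  iota_unique := huniq
  iotaYdd := iotaYddOfAut C hchar α
  iotaYdd_lifts := ⟨1, by rw [map_one, map_one], fun y => by rw [inv_one, mul_one, one_mul]; rfl⟩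
  Dmu := Dmu
  Dmu_le := hDmu
  iotaYdd_fixes := hfix
  HDmu := Additive (ContH1 (phi C) (D.lDeltaTheta l) Dmu)
  resDmu := resDmuOf C Dmu hDmu
  etaStd := etaStd
  etaStd_mem := hmem
  standard := hstd

/-- The inhabitant's `iota` IS `α`. [claim: Mochizuki2012, status: disputed] (IUTchII §1 Rmk 1.4.1 (ii), kurims p.28) -/
@[simp] theorem pointedInversionOfPair_iota (hC : D.Compat) (hS : D.Sec2Hyps) (hchar : PiYddCharacteristic C)
    (S : ThetaSetting.{0}) (eS : (Pi C) ≃ₜ* S.PiX) (hl : S.l = l) (Env : EnvOfGroup S (Pi C)) (α : (Pi C) ≃ₜ* (Pi C)) (hover δ hδ hαα γ hγ hαγ huniq Dmu hDmu hfix etaStd hmem hstd) :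
    (pointedInversionOfPair C hC hS hchar S eS hl Env α hover δ hδ hαα γ hγ hαγ huniq Dmu hDmu hfix etaStd hmem hstd).iota = α :=
  rfl

/-- **Non-vacuity of `PointedInversion` at the model, RELATIVE form**: given the named print inputs, the binder type
`PointedInversion Env (etaleThetaDataOfSetting' …)` of `ThetaEvaluation` / `Prop22_i'` is inhabited.
[claim: Mochizuki2012, status: disputed] (IUTchII §1 Rmk 1.4.1 (ii), kurims pp.28-29) -/
theorem nonempty_pointedInversion_of_pair (hC : D.Compat) (hS : D.Sec2Hyps) (hchar : PiYddCharacteristic C)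
    (S : ThetaSetting.{0}) (eS : (Pi C) ≃ₜ* S.PiX) (hl : S.l = l) (Env : EnvOfGroup S (Pi C)) (α : (Pi C) ≃ₜ* (Pi C))
    (hover : ∀ x : Pi C, Env.recon.projG (Env.isoX (α x)) = Env.recon.projG (Env.isoX x))
    (δ : Pi C) (hδ : Env.recon.projG (Env.isoX δ) = 1) (hαα : ∀ x : Pi C, α (α x) = δ * x * δ⁻¹)
    (γ : Pi C) (hγ : C.toLZ γ = Multiplicative.ofAdd 1) (hαγ : C.toLZ (α γ) = Multiplicative.ofAdd (-1))
    (huniq : ∀ κ : (Pi C) ≃ₜ* (Pi C),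
      (∀ x : Pi C, Env.recon.projG (Env.isoX (κ x)) = Env.recon.projG (Env.isoX x)) →
      (∃ δ' : Pi C, Env.recon.projG (Env.isoX δ') = 1 ∧ ∀ x : Pi C, κ (κ x) = δ' * x * δ'⁻¹) →
      (¬ ∃ δ' : Pi C, Env.recon.projG (Env.isoX δ') = 1 ∧ ∀ x : Pi C, κ x = δ' * x * δ'⁻¹) →
        ∃ δ' : Pi C, Env.recon.projG (Env.isoX δ') = 1 ∧ ∀ x : Pi C, κ x = δ' * α x * δ'⁻¹)
    (Dmu : Subgroup (Pi C)) (hDmu : Dmu ≤ PiYdd C)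
    (hfix : ∃ δ' : ↥(PiYdd C), Env.recon.projG (Env.isoX (δ' : Pi C)) = 1 ∧
      ∀ d : Pi C, ∀ hd : d ∈ Dmu, ((iotaYddOfAut C hchar α ⟨d, hDmu hd⟩ : PiYdd C) : Pi C) ∈
        Dmu.map (MulAut.conj (δ' : Pi C)).toMonoidHom)
    (etaStd : (coh C).H1 ⊤) (hmem : etaStd ∈ orbitOne C hC) (hstd : (2 * S.l) • resDmuOf C Dmu hDmu etaStd = 0) :
    Nonempty (PointedInversion Env (etaleThetaDataOfSetting' C hC hS hchar S eS hl)) :=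
  ⟨pointedInversionOfPair C hC hS hchar S eS hl Env α hover δ hδ hαα γ hγ hαγ huniq Dmu hDmu hfix etaStd hmem hstd⟩

end Pair

/-! ## §3. At the (R1) inversion `α := ι|Π^tp_X̲̲` -/

section Inversion

/-- **The pointed inversion at the model with `iota := ι|Π^tp_X̲̲`** for an automorphism `ι` of the [EtTh] §1 tempered group `Π^tp_X`
stabilising `Π^tp_X̲̲` (GAP row G-w4d010-2 (R1)): `iota_sq_inner` from `ι² = conj e` with `e ∈ Π^tp_X̲̲ ∩ Δ` (abc-iut-w5-d072
`inversionAlpha_inversionAlpha_of_sq`), `iota_not_inner` from the `ℤ`-reversal `toZ (ι γ) = (toZ γ)⁻¹` (`toLZ_inversionAlpha_generator`);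
the other inputs as in `pointedInversionOfPair`. At [EtTh] Def. 1.7's `MuTwoSetting` take `ι := epsPMInversion M hind`
(`ε_±`-conjugation; `e` with `inclX e = ε_±²`). [claim: Mochizuki2012, status: disputed] (IUTchII §1 Rmk 1.4.1 (ii), kurims pp.28-29) -/
def pointedInversionOfInversion (hC : D.Compat) (hS : D.Sec2Hyps) (hchar : PiYddCharacteristic C)
    (S : ThetaSetting.{0}) (eS : (Pi C) ≃ₜ* S.PiX) (hl : S.l = l) (Env : EnvOfGroup S (Pi C))
    (ι : D.PiTemp ≃ₜ* D.PiTemp) (hι : C.Huu.map ι.toMulEquiv.toMonoidHom = C.Huu)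
    (hover : ∀ x : Pi C, Env.recon.projG (Env.isoX (inversionAlpha C ι hι x)) = Env.recon.projG (Env.isoX x))
    (e : Pi C) (he : Env.recon.projG (Env.isoX e) = 1)
    (hsq : ∀ x : D.PiTemp, ι (ι x) = (e : D.PiTemp) * x * (e : D.PiTemp)⁻¹)
    (γ : Pi C) (hγ : C.toLZ γ = Multiplicative.ofAdd 1) (hZ : D.toZ (ι (γ : D.PiTemp)) = (D.toZ (γ : D.PiTemp))⁻¹)
    (huniq : ∀ κ : (Pi C) ≃ₜ* (Pi C),
      (∀ x : Pi C, Env.recon.projG (Env.isoX (κ x)) = Env.recon.projG (Env.isoX x)) →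
      (∃ δ' : Pi C, Env.recon.projG (Env.isoX δ') = 1 ∧ ∀ x : Pi C, κ (κ x) = δ' * x * δ'⁻¹) →
      (¬ ∃ δ' : Pi C, Env.recon.projG (Env.isoX δ') = 1 ∧ ∀ x : Pi C, κ x = δ' * x * δ'⁻¹) →
        ∃ δ' : Pi C, Env.recon.projG (Env.isoX δ') = 1 ∧ ∀ x : Pi C, κ x = δ' * inversionAlpha C ι hι x * δ'⁻¹)
    (Dmu : Subgroup (Pi C)) (hDmu : Dmu ≤ PiYdd C)
    (hfix : ∃ δ' : ↥(PiYdd C), Env.recon.projG (Env.isoX (δ' : Pi C)) = 1 ∧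
      ∀ d : Pi C, ∀ hd : d ∈ Dmu, ((iotaYddOfAut C hchar (inversionAlpha C ι hι) ⟨d, hDmu hd⟩ : PiYdd C) : Pi C) ∈
        Dmu.map (MulAut.conj (δ' : Pi C)).toMonoidHom)
    (etaStd : (coh C).H1 ⊤) (hmem : etaStd ∈ orbitOne C hC) (hstd : (2 * S.l) • resDmuOf C Dmu hDmu etaStd = 0) :
    PointedInversion Env (etaleThetaDataOfSetting' C hC hS hchar S eS hl) :=
  pointedInversionOfPair C hC hS hchar S eS hl Env (inversionAlpha C ι hι) hover e he
    (inversionAlpha_inversionAlpha_of_sq C ι hι e hsq) γ hγ (toLZ_inversionAlpha_generator C ι hι γ hγ hZ) huniq Dmu hDmu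
    hfix etaStd hmem hstd

/-- Its `iota` IS `inversionAlpha C ι hι` (so that `ThetaEvaluation.iotaLim := pairRhoLim …` at this inhabitant is the action of the
SAME automorphism). [claim: Mochizuki2012, status: disputed] (IUTchII §1 Rmk 1.4.1 (ii), kurims p.28) -/
@[simp] theorem pointedInversionOfInversion_iota (hC : D.Compat) (hS : D.Sec2Hyps) (hchar : PiYddCharacteristic C)
    (S : ThetaSetting.{0}) (eS : (Pi C) ≃ₜ* S.PiX) (hl : S.l = l) (Env : EnvOfGroup S (Pi C))
    (ι : D.PiTemp ≃ₜ* D.PiTemp) (hι : C.Huu.map ι.toMulEquiv.toMonoidHom = C.Huu)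
    (hover e he hsq γ hγ hZ huniq Dmu hDmu hfix etaStd hmem hstd) :
    (pointedInversionOfInversion C hC hS hchar S eS hl Env ι hι hover e he hsq γ hγ hZ huniq Dmu hDmu hfix etaStd hmem
      hstd).iota = inversionAlpha C ι hι :=
  rfl

end Inversion

end EtaleThetaDataOfSetting

end

end Literature.IUT.HodgeArakelov
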